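import Summits.ABC.StewartYu.GenThreeInductionTwo
import Literature.NumberTheory.DiophantineGeometry.SmallMultiplicativeRelation
import Summits.ABC.StewartYu.ShapeDepElimPrelims
import HarnessLib

/-!
# Cell abc-stewartyu — draft route `YuMatveevShapeRat` (plan-m3 g2, HOME/plan-m3/next/SketchGA.lean):
# the `2`-adic DEPENDENCE-REMOVAL step in SHAPE form, proved

Cell `abc-stewartyu` (HOME `run/shared/lean/pub/abc-stewartyu/`; seat `lit-abc-yu2007` g3). Theorems only;
no definition, no named fact, nothing closed. Twin of `PadicShapeDepElimOdd.lean` at `p = 2`: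
`padicShape_dep_of_indep_two` — if, for some real `c`, the Kummer-free `2`-adic SHAPE bound
`ord₂(∏ θᵢ^{mᵢ} − 1) ≤ cʳ ∏Aᵢ (W + log 2A_max)` holds for all MULTIPLICATIVELY INDEPENDENT rationals
`θᵢ ≡ 1 (mod 8)` (`h(θᵢ) ≤ Aᵢ`, `1 ≤ Aᵢ ≤ A_max`, `m ≠ 0`, `log max(3,|mᵢ|) ≤ W`, `1 ≤ W`) — the
planner's text of the crux `PadicCoreTwoRat`, verbatim — then with `c' = max |c| 20` it holds for ALL
rationals `≡ 1 (mod 8)` as soon as `∏ θᵢ^{mᵢ} ≠ 1`: the second "dependence removal" ingredient of the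
draft item `PadicShapeChain`. Method as in the odd case (Matveev 2000 §21 in shape currency, one relation
at a time, `2`-adic Liouville disposal `ord₂(Ξ − 1) log 2 ≤ log 2 + ∑|mᵢ|h(θᵢ)`, transfer of the
valuation along the relation by `yu2007_dep_transfer`). WHAT THIS IS NOT: no analytic estimate; no crux
moved; no abc claim. References: [Matveev2000] Izv. Math. 64 (2000) 1217–1269, §21; [Yu2007] Forum Math.
19 (2007) 187–280; [EvertseGyory2015] pp. 80–81.
-/

open Height Real Finset
open Literature.NumberTheory.DiophantineGeometry.Dioph

noncomputable section

namespace Summit.ABC.StewartYu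

namespace PadicShapeDepElim

open ShapeDepElim

set_option maxHeartbeats 400000 in
/-- The dependence removal at `p = 2` on a general finite index type (strong induction on its size).
[cite: Matveev2000, §21 (pp. 173–176)] -/
theorem dep_elim_two {C : ℝ} (hC : 20 ≤ C)
    (hcore : ∀ (κ : Type) [Fintype κ], ∀ (θ : κ → ℚ) (b : κ → ℤ) (A : κ → ℝ) (Amax W : ℝ),
      (∀ k, 3 ≤ padicValRat 2 (θ k - 1)) → (∀ μ : κ → ℤ, ∏ k, θ k ^ μ k = 1 → μ = 0) →
      (∀ k, logHeight₁ (θ k) ≤ A k) → (∀ k, (1 : ℝ) ≤ A k) → (∀ k, A k ≤ Amax) → b ≠ 0 →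
      (∀ k, Real.log (max 3 |(b k : ℝ)|) ≤ W) → 1 ≤ W →
      (padicValRat 2 (∏ k, θ k ^ b k - 1) : ℝ) ≤
        C ^ Fintype.card κ * (∏ k, A k) * (W + Real.log (2 * Amax)))
    (n : ℕ) :
    ∀ (κ : Type) [Fintype κ], Fintype.card κ = n →
      ∀ (θ : κ → ℚ) (b : κ → ℤ) (A : κ → ℝ) (Amax W : ℝ),
      (∀ k, 3 ≤ padicValRat 2 (θ k - 1)) →
      (∀ k, logHeight₁ (θ k) ≤ A k) → (∀ k, (1 : ℝ) ≤ A k) → (∀ k, A k ≤ Amax) →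
      (∀ k, Real.log (max 3 |(b k : ℝ)|) ≤ W) → 1 ≤ W → ∏ k, θ k ^ b k ≠ 1 →
      (padicValRat 2 (∏ k, θ k ^ b k - 1) : ℝ) ≤ C ^ n * (∏ k, A k) * (W + Real.log (2 * Amax)) := by
  induction n using Nat.strong_induction_on with
  | _ n IH =>
  intro κ _ hcard θ b A Amax W h8 hAh hA1 hAm hbW hW1 hΞ
  classical
  haveI : Fact (Nat.Prime 2) := ⟨Nat.prime_two⟩
  have hu : ∀ k, θ k ≠ 0 ∧ padicValRat 2 (θ k) = 0 := fun k =>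
    ⟨TwoSetup.ne_zero_of_three_le (h8 k), GenThreeInductionTwo.padicValRat_eq_zero_of_three_le (h8 k)⟩
  have hb : b ≠ 0 := by rintro rfl; exact hΞ (by simp)
  obtain ⟨k₁, hk₁⟩ : ∃ k, b k ≠ 0 := by by_contra h; push Not at h; exact hb (funext h)
  obtain ⟨m, rfl⟩ : ∃ m, n = m + 1 :=
    ⟨n - 1, by have : 0 < n := hcard ▸ Fintype.card_pos_iff.mpr ⟨k₁⟩; omega⟩
  have hA0 : ∀ k, 0 < A k := fun k => lt_of_lt_of_le one_pos (hA1 k)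
  have hAmax : 1 ≤ Amax := (hA1 k₁).trans (hAm k₁)
  have hL2A : 0 ≤ Real.log (2 * Amax) := Real.log_nonneg (by linarith)
  set G := W + Real.log (2 * Amax) with hG
  have hG1 : 1 ≤ G := by rw [hG]; linarith
  have hC0 : 0 < C := by linarith
  have heW : Real.exp 1 ≤ Real.exp W := Real.exp_le_exp.mpr hW1
  have he1 := Real.exp_one_gt_d9
  have hl2 : (2 : ℝ) / 3 < Real.log 2 := by have := Real.log_two_gt_d9; linarith
  have hl2' : Real.log 2 < 1 := by have := Real.log_two_lt_d9; linarith
  have hbE : ∀ k, |(b k : ℝ)| ≤ Real.exp W := fun k => abs_le_exp_of_log_max_le (hbW k)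
  obtain ⟨ks, -, hks⟩ := Finset.exists_max_image univ A (univ_nonempty_iff.mpr ⟨k₁⟩)
  have hks' : ∀ k, A k ≤ A ks := fun k => hks k (mem_univ k)
  set P := ∏ k ∈ univ.erase ks, A k with hP
  have hP1 : 1 ≤ P := by
    rw [hP, ← Finset.prod_const_one (s := univ.erase ks)]
    exact Finset.prod_le_prod (fun _ _ => zero_le_one) fun k _ => hA1 k
  have hsplit : ∏ k, A k = A ks * P := (Finset.mul_prod_erase univ A (mem_univ ks)).symm
  -- (L) Liouville: `ord₂(Ξ − 1) log 2 ≤ log 2 + (m+1) e^W A_{ks}`, so `ord₂(Ξ − 1) ≤ 3 (m+1) e^W A_{ks}`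
  have hLiou : (padicValRat 2 (∏ k, θ k ^ b k - 1) : ℝ) ≤ 3 * (((m : ℝ) + 1) * Real.exp W * A ks) := by
    have h1 := padic_liouville Nat.prime_two θ b hΞ
    have h2 : ∑ k, |(b k : ℝ)| * logHeight₁ (θ k) ≤ ∑ _k : κ, Real.exp W * A ks := by
      refine Finset.sum_le_sum fun k _ => ?_
      exact mul_le_mul (hbE k) ((hAh k).trans (hks' k)) (Height.zero_le_logHeight₁ _)
        (Real.exp_pos W).le
    rw [Finset.sum_const, card_univ, hcard, nsmul_eq_mul] at h2
    push_cast at h1 h2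
    have h3 : (1 : ℝ) * 1 * 1 ≤ ((m : ℝ) + 1) * Real.exp W * A ks :=
      mul_le_mul (mul_le_mul (by simp) (by linarith) zero_le_one (by positivity)) (hA1 ks)
        zero_le_one (by positivity)
    -- `v log 2 ≤ log 2 + Y` with `Y ≥ 1` gives `v ≤ 1 + Y / log 2 ≤ 1 + 1.5 Y ≤ 3Y`
    set v := (padicValRat 2 (∏ k, θ k ^ b k - 1) : ℝ) with hv
    set Y := ((m : ℝ) + 1) * Real.exp W * A ks with hY
    have h4 : v * Real.log 2 ≤ Real.log 2 + Y := by linarith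
    by_contra h5
    push Not at h5
    have h6 : 3 * Y * Real.log 2 < v * Real.log 2 := mul_lt_mul_of_pos_right h5 (by linarith)
    nlinarith
  by_cases hLcase : 3 * (((m : ℝ) + 1) * Real.exp W * A ks) ≤ C ^ (m + 1) * (∏ k, A k) * G
  · exact hLiou.trans hLcase
  -- (†) `C^{m+1} P < 3 (m+1) e^W`
  have hdag : C ^ (m + 1) * P < 3 * ((m : ℝ) + 1) * Real.exp W := by
    push Not at hLcase
    rw [hsplit] at hLcase
    have h3 : C ^ (m + 1) * P * 1 * A ks ≤ C ^ (m + 1) * P * G * A ks :=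
      mul_le_mul_of_nonneg_right (mul_le_mul_of_nonneg_left hG1 (by positivity)) (hA0 ks).le
    have h4 : C ^ (m + 1) * (A ks * P) * G = C ^ (m + 1) * P * G * A ks := by ring
    have h5 : (C ^ (m + 1) * P) * A ks < (3 * ((m : ℝ) + 1) * Real.exp W) * A ks := by nlinarith
    exact lt_of_mul_lt_mul_right h5 (hA0 ks).le
  by_cases hind : ∀ μ : κ → ℤ, ∏ k, θ k ^ μ k = 1 → μ = 0
  · -- independent: the core
    have h := hcore κ θ b A Amax W h8 hind hAh hA1 hAm hb hbW hW1
    rwa [hcard] at h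
  -- dependent: a small relation on a minimal support `S`
  push Not at hind
  obtain ⟨μ, hμ, hμ0⟩ := hind
  obtain ⟨S, t, hSne, hsupp, htrel, hbd⟩ := exists_small_mult_relation (fun k => (hu k).1) hμ0 hμ
  obtain ⟨j, hj, hT⟩ := exists_elim_index hSne ks
  have htj : t j ≠ 0 := (hsupp j).mpr hj
  have hrj : (2 * t j : ℤ) ≠ 0 := mul_ne_zero two_ne_zero htj
  -- the size of the relation: `R = 2 ∏_{S∖j} 3A ≤ 2·3^m·P ≤ e^W`
  set R := 2 * ∏ l ∈ S.erase j, (3 * A l) with hR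
  obtain ⟨hRj, hRk⟩ := relation_bounds hAh hbd hj
  have hU : (univ.erase ks).card = m := by
    rw [Finset.card_erase_of_mem (mem_univ ks), card_univ, hcard]; rfl
  have hR1 : 1 ≤ R := by
    have : (1 : ℝ) ≤ |((2 * t j : ℤ) : ℝ)| := by rw [← Int.cast_abs]; exact_mod_cast Int.one_le_abs hrj
    linarith
  have hRE : R ≤ Real.exp W := by
    have h1 : ∏ l ∈ S.erase j, (3 * A l) ≤ (3 : ℝ) ^ m * P := by
      have := prod_three_mul_le hA1 hT; rwa [hU] at this
    have h2 : 6 * ((m : ℝ) + 1) * (3 : ℝ) ^ m ≤ C ^ (m + 1) := six_mul_three_pow_le hC m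
    have h3m : 0 ≤ (3 : ℝ) ^ m := by positivity
    have h3 : R * C ^ (m + 1) ≤ Real.exp W * C ^ (m + 1) := by
      calc R * C ^ (m + 1) ≤ (2 * ((3 : ℝ) ^ m * P)) * C ^ (m + 1) :=
            mul_le_mul_of_nonneg_right (by rw [hR]; linarith) (by positivity)
        _ = 2 * (3 : ℝ) ^ m * (C ^ (m + 1) * P) := by ring
        _ ≤ 2 * (3 : ℝ) ^ m * (3 * ((m : ℝ) + 1) * Real.exp W) :=
            mul_le_mul_of_nonneg_left hdag.le (by positivity)
        _ = (6 * ((m : ℝ) + 1) * 3 ^ m) * Real.exp W := by ring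
        _ ≤ C ^ (m + 1) * Real.exp W := mul_le_mul_of_nonneg_right h2 (Real.exp_pos W).le
        _ = Real.exp W * C ^ (m + 1) := by ring
    exact le_of_mul_le_mul_right h3 (by positivity)
  -- the new exponents `b'ₖ = 2tⱼ bₖ − 2tₖ bⱼ` are `≤ 2 R Aⱼ e^W`; the new `W' = W + log(2RAⱼ)`
  have hAj := hA1 j
  set W' := W + Real.log (2 * R * A j) with hW'
  have hM3 : (3 : ℝ) ≤ 2 * R * A j * Real.exp W := by
    have h := mul_le_mul (one_le_mul_of_one_le_of_one_le hR1 hAj) (show (2 : ℝ) ≤ Real.exp W by linarith)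
      zero_le_two (by nlinarith)
    linarith
  have hbW' : ∀ k : {k // k ≠ j},
      Real.log (max 3 |((2 * t j * b k.val - 2 * t k.val * b j : ℤ) : ℝ)|) ≤ W' := by
    intro k
    have h1 : |((2 * t j : ℤ) : ℝ)| * |(b k.val : ℝ)| ≤ R * Real.exp W :=
      mul_le_mul hRj (hbE k.val) (abs_nonneg _) (by linarith)
    have h2 : |((2 * t k.val : ℤ) : ℝ)| * |(b j : ℝ)| ≤ R * A j * Real.exp W := by
      by_cases hkS : k.val ∈ S
      · have h3 : |((2 * t k.val : ℤ) : ℝ)| ≤ R * A j := by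
          have h4 := hRk k.val hkS
          have h5 : |((2 * t k.val : ℤ) : ℝ)| * 1 ≤ |((2 * t k.val : ℤ) : ℝ)| * A k.val :=
            mul_le_mul_of_nonneg_left (hA1 _) (abs_nonneg _)
          linarith
        exact mul_le_mul h3 (hbE j) (abs_nonneg _) (by nlinarith)
      · have htk : t k.val = 0 := by by_contra h; exact hkS ((hsupp _).mp h)
        rw [htk, mul_zero, Int.cast_zero, abs_zero, zero_mul]
        exact mul_nonneg (mul_nonneg (by linarith) (by linarith)) (Real.exp_pos W).le
    have h6 : |((2 * t j * b k.val - 2 * t k.val * b j : ℤ) : ℝ)| ≤ 2 * R * A j * Real.exp W := by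
      have h3 : R * Real.exp W * 1 ≤ R * Real.exp W * A j :=
        mul_le_mul_of_nonneg_left hAj (mul_nonneg (by linarith) (Real.exp_pos W).le)
      calc |((2 * t j * b k.val - 2 * t k.val * b j : ℤ) : ℝ)|
          = |((2 * t j : ℤ) : ℝ) * (b k.val : ℝ) - ((2 * t k.val : ℤ) : ℝ) * (b j : ℝ)| := by
            push_cast; ring_nf
        _ ≤ |((2 * t j : ℤ) : ℝ) * (b k.val : ℝ)| + |((2 * t k.val : ℤ) : ℝ) * (b j : ℝ)| := abs_sub _ _
        _ = |((2 * t j : ℤ) : ℝ)| * |(b k.val : ℝ)| + |((2 * t k.val : ℤ) : ℝ)| * |(b j : ℝ)| := by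
            rw [abs_mul, abs_mul]
        _ ≤ R * Real.exp W + R * A j * Real.exp W := add_le_add h1 h2
        _ ≤ 2 * R * A j * Real.exp W := by linarith
    have h7 : max 3 |((2 * t j * b k.val - 2 * t k.val * b j : ℤ) : ℝ)| ≤ 2 * R * A j * Real.exp W :=
      max_le hM3 h6
    have h8 : 0 < max 3 |((2 * t j * b k.val - 2 * t k.val * b j : ℤ) : ℝ)| :=
      lt_of_lt_of_le (by norm_num) (le_max_left _ _)
    calc Real.log (max 3 |((2 * t j * b k.val - 2 * t k.val * b j : ℤ) : ℝ)|)
        ≤ Real.log (2 * R * A j * Real.exp W) := Real.log_le_log h8 h7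
      _ = W' := by
          rw [hW', Real.log_mul (by positivity) (Real.exp_pos W).ne', Real.log_exp]; ring
  have hRpos : 0 < 2 * R * A j := by positivity
  have hlog2R : 0 ≤ Real.log (2 * R * A j) := Real.log_nonneg (by nlinarith)
  have hW'1 : 1 ≤ W' := by rw [hW']; linarith
  have hW'le : W' ≤ 2 * W + A j := by
    have h1 : Real.log (2 * R * A j) = Real.log 2 + Real.log R + Real.log (A j) := by
      rw [Real.log_mul (by positivity) (hA0 j).ne', Real.log_mul (by norm_num) (by positivity)]
    have h2 : Real.log R ≤ W := by
      have := Real.log_le_log (by linarith) hRE; rwa [Real.log_exp] at this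
    have h4 : Real.log (A j) ≤ A j - 1 := Real.log_le_sub_one_of_pos (hA0 j)
    rw [hW', h1]; linarith
  -- transfer of the valuation along the relation, induction hypothesis for the `m` units `k ≠ j`
  have hΛ0 : ∏ k, θ k ^ b k - 1 ≠ 0 := sub_ne_zero.mpr hΞ
  have hRHS1 : (1 : ℝ) ≤ C ^ (m + 1) * (∏ k, A k) * G := by
    have h1 : (1 : ℝ) ≤ C ^ (m + 1) := one_le_pow₀ (by linarith)
    have h2 : (1 : ℝ) ≤ ∏ k, A k := by
      rw [hsplit]; exact one_le_mul_of_one_le_of_one_le (hA1 ks) hP1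
    exact one_le_mul_of_one_le_of_one_le (one_le_mul_of_one_le_of_one_le h1 h2) hG1
  rcases Literature.Barriers.ABC.yu2007_dep_transfer (fun k => (hu k).1) (fun k => (hu k).2) b htrel
    (j := j) hrj hΛ0 with hle1 | ⟨hΞ'ne, hle⟩
  · have h1 : (padicValRat 2 (∏ k, θ k ^ b k - 1) : ℝ) ≤ 1 := by exact_mod_cast hle1
    linarith
  have hcard' : Fintype.card {k // k ≠ j} = m := card_subtype_ne j hcard
  have hΞ' : ∏ k : {k // k ≠ j}, θ k.val ^ (2 * t j * b k.val - 2 * t k.val * b j) ≠ 1 := by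
    rw [prod_subtype_ne j (fun k => θ k ^ (2 * t j * b k - 2 * t k * b j))]; exact sub_ne_zero.mp hΞ'ne
  have hI := IH m (lt_add_one m) {k // k ≠ j} hcard' (fun k => θ k.val)
    (fun k => 2 * t j * b k.val - 2 * t k.val * b j) (fun k => A k.val) Amax W' (fun k => h8 k.val)
    (fun k => hAh k.val) (fun k => hA1 k.val) (fun k => hAm k.val) hbW' hW'1 hΞ'
  rw [prod_subtype_ne j (fun k => θ k ^ (2 * t j * b k - 2 * t k * b j)), prod_subtype_ne j A] at hI
  set Pj := ∏ k ∈ univ.erase j, A k with hPj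
  have hsplitj : ∏ k, A k = A j * Pj := (Finset.mul_prod_erase univ A (mem_univ j)).symm
  have hle' : (padicValRat 2 (∏ k, θ k ^ b k - 1) : ℝ) ≤
      (padicValRat 2 (∏ k ∈ univ.erase j, θ k ^ (2 * t j * b k - 2 * t k * b j) - 1) : ℝ) := by
    exact_mod_cast hle
  -- numerics: `C^m Pj (W' + L) ≤ C^m Pj G (2 + Aⱼ) ≤ C^{m+1} (Aⱼ Pj) G`
  rw [hsplitj]
  have hPj1 : 1 ≤ Pj := by
    rw [hPj, ← Finset.prod_const_one (s := univ.erase j)]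
    exact Finset.prod_le_prod (fun _ _ => zero_le_one) fun k _ => hA1 k
  set X := C ^ m * Pj with hX
  have hX0 : 0 ≤ X := mul_nonneg (pow_nonneg hC0.le m) (zero_le_one.trans hPj1)
  have h1a : A j * 1 ≤ A j * G := mul_le_mul_of_nonneg_left hG1 (hA0 j).le
  have h1 : W' + Real.log (2 * Amax) ≤ G * (2 + A j) := by linarith [hW'le, hL2A, h1a, hG]
  have h2 : X * (W' + Real.log (2 * Amax)) ≤ X * (G * (2 + A j)) := mul_le_mul_of_nonneg_left h1 hX0
  have h3 : 2 + A j ≤ C * A j := by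
    have h3a : 19 * A j ≤ (C - 1) * A j := mul_le_mul_of_nonneg_right (by linarith) (hA0 j).le
    linarith
  have h4 : X * (G * (2 + A j)) ≤ X * (G * (C * A j)) :=
    mul_le_mul_of_nonneg_left (mul_le_mul_of_nonneg_left h3 (zero_le_one.trans hG1)) hX0
  have h5 : C ^ (m + 1) * (A j * Pj) * G = X * (G * (C * A j)) := by rw [hX]; ring
  rw [h5]
  exact hle'.trans (hI.trans (h2.trans h4))

/-- From the `Fin r`-indexed core to every finite index type, constant `max |c| 20`. [folklore] -/
theorem core_fintype_two {c : ℝ}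
    (hc : ∀ (r : ℕ) (θ : Fin r → ℚ) (m : Fin r → ℤ) (A : Fin r → ℝ) (Amax W : ℝ),
      (∀ i, 3 ≤ padicValRat 2 (θ i - 1)) →
      (∀ μ : Fin r → ℤ, ∏ i, θ i ^ μ i = 1 → μ = 0) →
      (∀ i, Height.logHeight₁ (θ i) ≤ A i) → (∀ i, 1 ≤ A i) → (∀ i, A i ≤ Amax) →
      m ≠ 0 → (∀ i, Real.log (max 3 (|m i| : ℝ)) ≤ W) → 1 ≤ W →
      (padicValRat 2 (∏ i, θ i ^ m i - 1) : ℝ) ≤ c ^ r * (∏ i, A i) * (W + Real.log (2 * Amax)))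
    (κ : Type) [Fintype κ] (θ : κ → ℚ) (b : κ → ℤ) (A : κ → ℝ) (Amax W : ℝ)
    (h8 : ∀ k, 3 ≤ padicValRat 2 (θ k - 1)) (hind : ∀ μ : κ → ℤ, ∏ k, θ k ^ μ k = 1 → μ = 0)
    (hAh : ∀ k, logHeight₁ (θ k) ≤ A k) (hA1 : ∀ k, (1 : ℝ) ≤ A k) (hAm : ∀ k, A k ≤ Amax)
    (hb : b ≠ 0) (hbW : ∀ k, Real.log (max 3 |(b k : ℝ)|) ≤ W) (hW1 : 1 ≤ W) :
    (padicValRat 2 (∏ k, θ k ^ b k - 1) : ℝ) ≤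
      (max |c| 20) ^ Fintype.card κ * (∏ k, A k) * (W + Real.log (2 * Amax)) := by
  set r := Fintype.card κ with hr
  set e : κ ≃ Fin r := Fintype.equivFin κ with he
  have hind' : ∀ μ : Fin r → ℤ, ∏ i, (θ (e.symm i)) ^ μ i = 1 → μ = 0 := by
    intro μ hμ
    have h1 : ∏ k, θ k ^ μ (e k) = 1 := by
      rw [← hμ]; exact (Fintype.prod_equiv e _ _ fun k => by simp)
    have h2 := hind (fun k => μ (e k)) h1
    funext i
    have := congr_fun h2 (e.symm i)
    simpa using this
  obtain ⟨k₁, hk₁⟩ : ∃ k, b k ≠ 0 := by by_contra h; push Not at h; exact hb (funext h)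
  have hb' : (fun i => b (e.symm i)) ≠ 0 := by
    intro h; apply hk₁; have := congr_fun h (e k₁); simpa using this
  have h := hc r (fun i => θ (e.symm i)) (fun i => b (e.symm i)) (fun i => A (e.symm i)) Amax W
    (fun i => h8 _) hind' (fun i => hAh _) (fun i => hA1 _) (fun i => hAm _) hb' (fun i => hbW _) hW1
  rw [Fintype.prod_equiv e.symm (fun i => A (e.symm i)) A fun i => rfl, Fintype.prod_equiv e.symm
    (fun i => θ (e.symm i) ^ b (e.symm i)) (fun k => θ k ^ b k) fun i => rfl] at h
  have hAmax : 1 ≤ Amax := (hA1 k₁).trans (hAm k₁)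
  have hG0 : 0 ≤ W + Real.log (2 * Amax) := by
    have := Real.log_nonneg (show (1 : ℝ) ≤ 2 * Amax by linarith); linarith
  have hP0 : 0 ≤ ∏ k, A k := Finset.prod_nonneg fun k _ => (lt_of_lt_of_le one_pos (hA1 k)).le
  have hpow : c ^ r ≤ (max |c| 20) ^ r :=
    le_trans (le_abs_self _) (by rw [abs_pow]; exact pow_le_pow_left₀ (abs_nonneg c) (le_max_left _ _) r)
  have : c ^ r * (∏ k, A k) * (W + Real.log (2 * Amax)) ≤
      (max |c| 20) ^ r * (∏ k, A k) * (W + Real.log (2 * Amax)) :=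
    mul_le_mul_of_nonneg_right (mul_le_mul_of_nonneg_right hpow hP0) hG0
  linarith

end PadicShapeDepElim

open PadicShapeDepElim in
/-- **Dependence removal for the Kummer-free `2`-adic shape bound over `ℚ`**: the hypothesis is the
planner's text of `PadicCoreTwoRat` (route draft `YuMatveevShapeRat`) verbatim; the conclusion is the same
bound, constant `max |c| 20`, for all rationals `θᵢ ≡ 1 (mod 8)` with `∏ θᵢ^{mᵢ} ≠ 1` (no independence).
[cite: Matveev2000, §21 (pp. 173–176)] -/
theorem padicShape_dep_of_indep_two
    (h : ∃ c : ℝ, ∀ (r : ℕ) (θ : Fin r → ℚ) (m : Fin r → ℤ) (A : Fin r → ℝ) (Amax W : ℝ),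
      (∀ i, 3 ≤ padicValRat 2 (θ i - 1)) →
      (∀ μ : Fin r → ℤ, ∏ i, θ i ^ μ i = 1 → μ = 0) →
      (∀ i, Height.logHeight₁ (θ i) ≤ A i) → (∀ i, 1 ≤ A i) → (∀ i, A i ≤ Amax) →
      m ≠ 0 → (∀ i, Real.log (max 3 (|m i| : ℝ)) ≤ W) → 1 ≤ W →
      (padicValRat 2 (∏ i, θ i ^ m i - 1) : ℝ) ≤ c ^ r * (∏ i, A i) * (W + Real.log (2 * Amax))) :
    ∃ c : ℝ, ∀ (r : ℕ) (θ : Fin r → ℚ) (m : Fin r → ℤ) (A : Fin r → ℝ) (Amax W : ℝ),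
      (∀ i, 3 ≤ padicValRat 2 (θ i - 1)) →
      (∀ i, Height.logHeight₁ (θ i) ≤ A i) → (∀ i, 1 ≤ A i) → (∀ i, A i ≤ Amax) →
      (∀ i, Real.log (max 3 (|m i| : ℝ)) ≤ W) → 1 ≤ W → ∏ i, θ i ^ m i ≠ 1 →
      (padicValRat 2 (∏ i, θ i ^ m i - 1) : ℝ) ≤ c ^ r * (∏ i, A i) * (W + Real.log (2 * Amax)) := by
  obtain ⟨c, hc⟩ := h
  exact ⟨max |c| 20, fun r θ m A Amax W h8 hAh hA1 hAm hmW hW1 hΞ =>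
    dep_elim_two (C := max |c| 20) (le_max_right _ _) (core_fintype_two hc) r (Fin r) (by simp)
      θ m A Amax W h8 hAh hA1 hAm hmW hW1 hΞ⟩

end Summit.ABC.StewartYu

end
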